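import Literature.NumberTheory.GelbartRogawski1991.UnitaryDualPairSeesawCMLinesMajorants
import Literature.NumberTheory.GelbartRogawski1991.UnitaryDualPairThetaKernelCMTwistDet
import Literature.NumberTheory.Automorphic.UnitaryGroupAdelicLineTorus
import Literature.NumberTheory.Automorphic.UnitaryGroupAdelicCenterRational
import HarnessLib

/-!
# The adelic unitary group of a CM hermitian LINE is the norm-one idèle torus: `ker N_{L/L⁺}(𝔸) ≃* U(⟨a⟩)(𝔸_{L⁺})`
# (Mok 2015 §1 Notation; Platonov–Rapinchuk §6.2)

Topic `NumberTheory/GelbartRogawski1991`; namespace `Literature.NumberTheory.GelbartRogawski1991.UnitaryDualPair` (the CM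
currency of `UnitaryDualPairThetaKernelCMTwist`: `CMAdelic`, `CMRat`, `CMAdelicOne`, `CMCenter`, `lineVec`).  Two small
DEFINITIONS WITH BODIES and their read-backs; no named fact, no instance, nothing of print asserted.

[Mok2014, §1 Notation p. 5]: «`U_{E/F}(1)` … the norm-one torus … is the centre of every `U_{E/F}(N)`»; for `N = 1` the
centre embedding `u ↦ u · 1₁` is an ISOMORPHISM `U(1)(𝔸_F) ≃ U(J)(𝔸_F)` for any non-singular `1 × 1` form `J` (inverse: the
determinant).  The tree has this for the form spelled `!![j]` (`UnitaryGroup.adelicLineEquiv`, `UnitaryGroupAdelicLineTorus`);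
the CM see-saw files spell the line `⟨a⟩` as `Matrix.diagonal (lineVec L a)` (`UnitaryDualPairSeesawCMLines`), a
propositionally-equal matrix but a different TYPE index, so the equivalence is re-cut here for an ARBITRARY non-singular
`J : Matrix (Fin 1) (Fin 1) E` and then composed with the identification `ker N_{L/L⁺}(𝔸_L) = U(1)(𝔸_{L⁺})` of the idèle torus
(`UnitaryGroup.cmAdelicOneEquivRelNormOne`, [PlatonovRapinchuk1994, §6.2]):

* §1 `adelicLineFormEquiv F E c J hJ : adelicOne F E c ≃* adelic F E c 1 J` (`= adelicCenter`, inverse `adelicDet`), continuous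
  both ways;
* §2 **`cmLineTorusEquiv L a ha0 : relNormOneIdeles L⁺ L ≃* CMAdelic L (lineVec L a)`**, `t ↦ (t♭) · 1₁` with
  `t♭ = (cmAdelicOneEquivRelNormOne L)⁻¹ t` — the map along which the CM line representations `cmLineRepFin_k` read the torus
  (`cmLineRepFin₀_apply_eq_smul_cmPairRep`: `… (v, CMCenter L (lineVec L (a 0)) ((cmAdelicOneEquivRelNormOne L).symm t)) …`) —
  with `cmLineTorusEquiv_apply` (that reading, `rfl`), continuity both ways, and
  **`cmLineTorusEquiv_mem_CMRat_iff`**: `t♭ · 1₁ ∈ U(⟨a⟩)(L⁺) ↔ t` principal (`relNormOneRat`) — rational points correspond.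

USE (Hodge-CM cell, P4 seat J-R): the `G`-side isomorphism `e` of `Weil1964/ThetaLiftTransportAdelic` between the model's torus
`relNormOneIdeles L⁺ L` (second member of `WeilPairData.kernelDatum`) and S6's `UnitaryGroup.adelic L⁺ L c 1 (diagonal (lineVec a))`
(second member of `UnitaryDualPair.thetaKernelDatum`), with the matching of arithmetic subgroups `hΓ` that `cosetCongr` needs.

## Mathlib / tree search
Tree: `UnitaryGroupAdelicLineTorus` (`adelicLineEquiv` for `!![j]`, `coe_eq_det_smul_one`), `UnitaryGroupAdelicCenter(Rational)`
(`adelicCenter`, `cm_adelicCenter_symm_mem_range_toAdelic`), `UnitaryGroupAdelicDet` (`adelicDet`, `adelicDet_adelicCenter`,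
`coe_adelicDet_toAdelic`, `continuous_adelicDet`), `UnitaryGroupAdelicOneTorus` (`cmAdelicOneEquivRelNormOne`),
`UnitaryDualPairSeesawCMLinesMajorants` (`continuous_adelicCenter`, `continuous_cmAdelicOneEquivRelNormOne_symm`),
`UnitaryDualPairThetaKernelCMTwistDet` (`continuous_cmAdelicOneEquivRelNormOne`), `RelNormOneTorus` (`mem_relNormOneRat_iff`).

## References
* [Mok2014] C. P. Mok, *Endoscopic classification of representations of quasi-split unitary groups*, Mem. AMS 235 (2015),
  §1 Notation p. 5.
* [PlatonovRapinchuk1994] V. Platonov, A. Rapinchuk, *Algebraic Groups and Number Theory* (1994), §6.2.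
-/

set_option autoImplicit false

noncomputable section

open scoped Matrix
open NumberField
open Literature.NumberTheory.Automorphic Literature.NumberTheory.Automorphic.UnitaryGroup

namespace Literature.NumberTheory.GelbartRogawski1991

namespace UnitaryDualPair

/-! ## §1 `U(1)(𝔸_F) ≃* U(J)(𝔸_F)` for a non-singular `1 × 1` form `J` -/

section LineForm

variable (F E : Type) [Field F] [Field E] [NumberField E] [Algebra F E] (c : E ≃ₐ[F] E) (J : Matrix (Fin 1) (Fin 1) E)
  (hJ : J.det ≠ 0)

/-- for a hermitian LINE every element of `U(J)(𝔸_F)` is central: `g = (det g) · 1₁`. [cite: Mok2014, §1 Notation p. 5] -/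
theorem adelicCenter_adelicDet_fin_one (g : adelic F E c 1 J) : adelicCenter F E c 1 J (adelicDet F E c 1 J hJ g) = g :=
  Subtype.ext (Units.ext ((coe_adelicCenter F E c 1 J _).trans (coe_eq_det_smul_one E _).symm))

/-- **`U(1)(𝔸_F) ≃* U(J)(𝔸_F)`** for a non-singular `1 × 1` form `J`: `u ↦ u · 1₁`, inverse `g ↦ det g` (the tree's
`adelicLineEquiv` is the case `J = !![j]`). [cite: Mok2014, §1 Notation p. 5] -/
def adelicLineFormEquiv : adelicOne F E c ≃* adelic F E c 1 J :=
  { adelicCenter F E c 1 J with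
    invFun := adelicDet F E c 1 J hJ
    left_inv := fun u => (adelicDet_adelicCenter F E c 1 J hJ u).trans (pow_one u)
    right_inv := fun g => adelicCenter_adelicDet_fin_one F E c J hJ g }

/-- `adelicLineFormEquiv` IS `adelicCenter` at `N = 1`. [cite: Mok2014, §1 Notation p. 5] -/
@[simp] theorem adelicLineFormEquiv_apply (u : adelicOne F E c) :
    adelicLineFormEquiv F E c J hJ u = adelicCenter F E c 1 J u := rfl

/-- its inverse IS `adelicDet`. [cite: Mok2014, §1 Notation p. 5] -/
@[simp] theorem adelicLineFormEquiv_symm_apply (g : adelic F E c 1 J) :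
    (adelicLineFormEquiv F E c J hJ).symm g = adelicDet F E c 1 J hJ g := rfl

/-- `adelicLineFormEquiv` is continuous. [cite: Mok2014, §1 Notation p. 5] -/
theorem continuous_adelicLineFormEquiv : Continuous (adelicLineFormEquiv F E c J hJ) :=
  continuous_adelicCenter F E c 1 J

/-- the inverse of `adelicLineFormEquiv` is continuous. [cite: Mok2014, §1 Notation p. 5] -/
theorem continuous_adelicLineFormEquiv_symm : Continuous (adelicLineFormEquiv F E c J hJ).symm :=
  continuous_adelicDet F E c 1 J hJ

end LineForm

/-! ## §2 `ker N_{L/L⁺}(𝔸_L) ≃* U(⟨a⟩)(𝔸_{L⁺})` for a CM line `⟨a⟩` -/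

section CM

variable (L : Type) [Field L] [NumberField L] [IsCMField L] (a : L) (ha0 : a ≠ 0)

omit [NumberField L] [IsCMField L] in
include ha0 in
/-- the `1 × 1` form `diagonal (lineVec a)` of the line `⟨a⟩` is non-singular. [cite: Mok2014, §1 Notation p. 5] -/
theorem det_diagonal_lineVec_ne_zero : (Matrix.diagonal (lineVec L a)).det ≠ 0 := by
  rw [Matrix.det_diagonal]
  simpa using ha0

/-- **`cmLineTorusEquiv L a : ker N_{L/L⁺}(𝔸_L) ≃* U(⟨a⟩)(𝔸_{L⁺})`**, `t ↦ t♭ · 1₁` (`t♭ = (cmAdelicOneEquivRelNormOne L)⁻¹ t`):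
the norm-one idèle torus IS the adelic unitary group of any CM hermitian line.
[cite: Mok2014, §1 Notation p. 5; PlatonovRapinchuk1994, §6.2] -/
def cmLineTorusEquiv : ↥(relNormOneIdeles (↥(maximalRealSubfield L)) L) ≃* CMAdelic L (lineVec L a) :=
  (cmAdelicOneEquivRelNormOne L).symm.trans
    (adelicLineFormEquiv (↥(maximalRealSubfield L)) L (IsCMField.complexConj L) (Matrix.diagonal (lineVec L a))
      (det_diagonal_lineVec_ne_zero L a ha0))

/-- **reading**: `cmLineTorusEquiv L a t = CMCenter L (lineVec L a) ((cmAdelicOneEquivRelNormOne L).symm t)` — the torus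
argument of `cmLineRepFin₀_apply_eq_smul_cmPairRep` (definitional). [cite: Mok2014, §1 Notation p. 5] -/
theorem cmLineTorusEquiv_apply (t : ↥(relNormOneIdeles (↥(maximalRealSubfield L)) L)) :
    cmLineTorusEquiv L a ha0 t = CMCenter L (lineVec L a) ((cmAdelicOneEquivRelNormOne L).symm t) := rfl

/-- the inverse reads the determinant back into the idèle torus. [cite: Mok2014, §1 Notation p. 5] -/
theorem cmLineTorusEquiv_symm_apply (g : CMAdelic L (lineVec L a)) :
    (cmLineTorusEquiv L a ha0).symm g =
      cmAdelicOneEquivRelNormOne L (cmAdelicDet L (lineVec L a) (fun _ => ha0) g) := rfl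

/-- `cmLineTorusEquiv` is continuous. [cite: Mok2014, §1 Notation p. 5] -/
theorem continuous_cmLineTorusEquiv : Continuous (cmLineTorusEquiv L a ha0) :=
  (continuous_adelicLineFormEquiv _ L _ _ (det_diagonal_lineVec_ne_zero L a ha0)).comp
    (continuous_cmAdelicOneEquivRelNormOne_symm L)

/-- the inverse of `cmLineTorusEquiv` is continuous. [cite: Mok2014, §1 Notation p. 5] -/
theorem continuous_cmLineTorusEquiv_symm : Continuous (cmLineTorusEquiv L a ha0).symm :=
  (continuous_cmAdelicOneEquivRelNormOne L).comp
    (continuous_adelicLineFormEquiv_symm _ L _ _ (det_diagonal_lineVec_ne_zero L a ha0))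

/-- **RATIONAL POINTS CORRESPOND**: `t♭ · 1₁ ∈ U(⟨a⟩)(L⁺)` iff `t` is a principal idèle (`relNormOneRat`).
[cite: PlatonovRapinchuk1994, §6.2; Mok2014, §1 Notation p. 5] -/
theorem cmLineTorusEquiv_mem_CMRat_iff (t : ↥(relNormOneIdeles (↥(maximalRealSubfield L)) L)) :
    cmLineTorusEquiv L a ha0 t ∈ CMRat L (lineVec L a) ↔ t ∈ relNormOneRat (↥(maximalRealSubfield L)) L := by
  refine ⟨fun h => ?_, fun h => cm_adelicCenter_symm_mem_range_toAdelic L 1 _ t h⟩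
  obtain ⟨γ, hγ⟩ := h
  rw [mem_relNormOneRat_iff]
  have hdet : cmAdelicDet L (lineVec L a) (fun _ => ha0) (cmLineTorusEquiv L a ha0 t) =
      (cmAdelicOneEquivRelNormOne L).symm t := by
    have h := congrArg (cmAdelicOneEquivRelNormOne L).symm ((cmLineTorusEquiv L a ha0).symm_apply_apply t)
    rw [cmLineTorusEquiv_symm_apply, MulEquiv.symm_apply_apply] at h
    convert h using 2
  refine ⟨Matrix.GeneralLinearGroup.det (γ : GL (Fin 1) L), ?_⟩
  have h2 := coe_adelicDet_toAdelic (↥(maximalRealSubfield L)) L (IsCMField.complexConj L) 1 (Matrix.diagonal (lineVec L a))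
    (det_diagonal_lineVec_ne_zero L a ha0) γ
  rw [hγ] at h2
  change ((cmAdelicDet L (lineVec L a) (fun _ => ha0) (cmLineTorusEquiv L a ha0 t) : CMAdelicOne L) : (AdeleRing (𝓞 L) L)ˣ) = _ at h2
  rw [hdet, coe_cmAdelicOneEquivRelNormOne_symm] at h2
  exact h2.symm

end CM

end UnitaryDualPair

end Literature.NumberTheory.GelbartRogawski1991
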